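import Summits.QuantumFields.YangMills.Theorems.BalabanUVNodesN06StatePairsAtPinsPU

/-!
# BalabanUVNodes ∕ N06 ([B9], `Dag.B9_main`) — R1 J-TWIN (STATE MACHINERY 3∕5): `StepS` + THE ONE-STEP PAIRS OF THE S-LEAVES' STATE TUPLES, ALONG A SUB-FAMILY
# `f : J → MemberY …` — the J-twin of ✓`…N06StatePairsAtPinsPU.hStatePairs_of_pinsP_geo9Y` (dag-n06-d g20∕g21, U8 state layer)

Track A of `YM-PLAN.md` (cell `pub-ymgap`, HUMAN RULING D-0062), node **N06** = [Balaban1985BackgroundPropagators]; IR-N06-SECTION-2 road **R1** («J-twin of the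
producer cone», ★★★ director-ym №524 (3): authorised in principle, STAGED, sibling files only), `R1-JTWIN-SPEC.md` rule (R)′ (dag-n06-d, 2026-08-31): re-key EXACTLY
the section-tainted ∀-member rows along `f`, keep data ∕ pins ∕ laws ∕ section-free rows member-wide, tainted conclusions along `f` ((R).3′).
Seat `pub-ymgap-dag-n06-d` g30 — the STATE-MACHINERY layer under dag-n06-l's (7)ᴶ ∕ (10)ᴶ ∕ L1ᴶ; leaf feeder 3∕4 of `…N06StateLayerAtPinsPUWParJ` (independent of the
other three).  The letter families `Ta Ta₂ Tb Tb₂` are PARAMETERS of the parent (the state layer instantiates them at the transporter-parametric split letters), so this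
one twin serves the straight and the `…Par` layers alike.

WHAT.  `hStatePairs_of_pinsP_geo9Y_J` = the parent's theorem with `{J : Type} (f : J → MemberY d ℓ hd hL b₀ b₁ Mstar)` added after the `H` binder and
* TAINTED ROW OF THIS TWIN: `hLS` — the (3.131)∕(3.137) letters `LettersS3131 …` on 𝔖₂ (output of ✓`…LettersSAtPinsPUParJ`, fed by (3.49) `h49`, the Δ⁽²⁾ letter `hD2`,
  T_a `hta`, T_b `htbH`), re-keyed `∀ x : MemberY … ↦ ∀ j : J`, read at `f j`;
* LEFT member-wide: the letter families `bH13 bXH 𝔬12 𝔭A Dd Ta Ta₂ Tb Tb₂`, the pins `hbH13 hκ13 hblkW12`, the laws `hlev hβ1`, the G₀-layer rows `hPG0 hPGD he1 he1d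
  h43L h43d hpX0 hdgDH hdgDHd hYd hXd hpXDv` (section-free: Theorem 3.3 outputs and the DgDvd∕XdYd∕Dv legs), all x-free numerics ∕ rates ∕ constants;
* conclusion `∃ MT, ∀ j : J, MT ≤ (geo9Y (f j)).M → … StepS … ∧ (pairs) …` along `f`.
PROOF: the parent's text by generator (`mkJ.py` over the tree bytes): x-free ∃-threshold `max M₀ (max Mg ML)`; pointwise body `fun x ↦ fun j`, member reads `x ↦ f j`,
`hLS x ↦ hLS j`; nothing re-derived.  The member-wide parent is the instance `J := MemberY …`, `f := id`.  ORPHAN by design until `…N06StateLayerAtPinsPUWParJ` lands.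
HONEST FRAMING.  Bookkeeping over landed objects; every displayed row is a HYPOTHESIS; nothing of [B9] ∕ [4] asserted; COUNT-NEUTRAL (`--supports stmt-QuantumFields-27239
--as helper`); N06 NOT discharged; K1 NOT closed; under R1 the inner-corner question stays DISPLAYED at the K1 face ∕ NODE O join by (α5); nothing continuum ∕ OS ∕
mass gap ∕ Clay.  0 `def`, 0 `sorry`.  NEW file; the parent untouched.
[cite: Balaban1985BackgroundPropagators, Thm 3.3 p.399, (3.42)–(3.47) pp.397–398, (3.130)–(3.131) pp.421–422, (3.138) p.423;
Balaban1984PropagatorsII, (2.51)–(2.54) pp.232–233, Lemma 2.1 (2.60)–(2.61) p.234]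
-/

noncomputable section

namespace Summit.QuantumFields.YangMills.BalabanUVNodes.N06StatePairsAtPinsPUJ

open Literature.MathematicalPhysics.QuantumFieldTheory.Balaban1983to89
open Literature.MathematicalPhysics.QuantumFieldTheory.Balaban1983to89.Node00 (FBondY IBondY SiteY CfgY SiteParY SiteOpY parSymY GpY GpPhysY BondOpY toKT)
open Literature.MathematicalPhysics.QuantumFieldTheory.Balaban1983to89.Node00.OpsYSectDCoords (DvcoKH DvscoKH TpicoK T2coK cR39_trBasis_pos)
open B9Thm39ReadingCoords (cR39)
open B9Thm34Ext (toB6)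
open B11SectG (HasMaj BlockNorm RowSum)
open B9Thm312Whole (cNorm GeoOK)
open B9Thm312WholeClasses (cNormR rwt rwt_nonneg cNormR_κ)
open B9RWSums343to347Whole (Facts347)
open B9CoReadingCoords (XBK blkBK)
open B9CoReadingCoordsS (XSK sIK blkSK GcoS)
open B9CoReadingCoordsH (XHK)
open B9CoReadingCoordsTranspose (TrIdx trBasis)
open B9PinMembersKLevelV1 (MemberY geo9Y)
open B9BackgroundsKLevelV1R (RegFamY bg9YR MemOfFam)
open B9GeoLemma21KLevelV1 (geo9Y_len_pos geo9Y_dist_triangle geo9Y_dist_comm rowSum261_geo9Y)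
open B9GeoNormsKLevelV1 (geo9K geo9K_dist_nonneg)
open B7Prop2SpecialUnitary (specialUnitaryUnits)
open B9PerturbationMajorantAlgebra (Proj349Maj Thm31GpMaj hasMaj_weaken)
open B9PerturbationMajorantsAtLetters (PcoK)
open B9MultiscaleSmoothPartitionYNear (rNear dist_sIK_le_of_nearY)
open B9SmoothHolderClassP (bHZKP bHZKPG bHZPG)
open B9GradViaDivLettersTransported (taxiB taxiS)
open B9PerturbationSplitAtLetters (TaLcoK TbLcoKH Ta2LcoK Tb2LcoKH tpi_t2_splitL_of_pins)
open B9PerturbationL2Delta2 (D2coK)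
open B9SmoothHolderClassPProducers (CTel CTel_nonneg CTel_mono CTel_mul)
open B9SmoothHolderClassTClosure (abs_cf_eq_nKT)
open B9RWSums347DefiniteFaces (geo9Y_scalars exp261 facts347_exp261_geo9Y)
open B9RowSum261DefiniteFaces (rowConst261 rowConst261_nonneg rowConst261_spec_of_rowSum261)
open B9SectDSup (weightNorm)
open B6RandomWalk (HasMajorant)
open B9Thm312WholeStepRegular (LettersS3131)
open B9Thm313WholeDelta2LettersAtStatePrint (ta2S_pins_print_of_h44G tb₂HS_pins_print_of_h43 hasMaj_state_of_raw_two)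
open Summit.QuantumFields.YangMills.BalabanUVNodes.N06HolderPinsGradedAtRecord (links_le_one)
open B6Prop22KLevelTorusCensusEta (nKT)
open B6GlobalChartV1 (PV blkV1) open B6Ineq2142KLevelV1 (β lvl) open B6Geom246MultiLevelTorus (geomT)
open scoped Matrix.Norms.L2Operator

open B9SmoothHolderClassState (hasMaj_id_state)
open B9SmoothHolderClassStateProducers (hasMaj_into_state_of_sup_probes)
open B9SmoothHolderClassStateDominated (exists_state_loc_le_sum)
open B9Thm312WholeStepDirRegular (readS_up)
open B9SectDSup (weightNorm_κ weightNorm_loc)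
open B9CoReadingCoordsHolder (PK blkPK probeK wK w₀K)
open B9CoReadingCoordsHolderAdm (wKA holderProbesKA)
open B9RWSums343Holder (HolderProbes)
open B9MultiscaleSmoothPartitionYLip (CLip)
open Summit.QuantumFields.YangMills.BalabanUVNodes.N06WELegAtPinsPhysPUB (hκX_of_pinsP)
open Literature.MathematicalPhysics.QuantumFieldTheory.Balaban1983to89.Node00 (parBY BondParY)

open B9Thm312WholeStepRegular (StepS stepS_of_lettersS)
open B9Thm312WholeStepDirRegular (stepDS_of_lettersS stepDdS_of_lettersS probeYS_of_lettersS probeXdS_of_lettersS probeXS_of_lettersS stepS_up fieldS_up)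
open B9PerturbationMajorantAlgebra (hasMaj_shift rpow_abs_eq_pow)
open B9MultiscaleSmoothPartitionYLip (CLip_nonneg)
open B9SmoothHolderClassPReadingsSite (hasMaj_id_bHZPG_cNorm)
open B9Thm312WholeClasses (hasMaj_cNormR_of_hasMajorantHom)
open B9Thm312WholeStepDirFrom3131 (hasMaj_probe_cNormR_of_hom)
open B9Thm313WholeHolder (hasMaj_toR_tgt)
open B9SmoothHolderClassState (hasMaj_rescale hasMaj_congr_src)
open B9LettersHZAtOne (plateau_pos)
open B11SectG (hasMaj_comp_exp)
open B9Thm312Whole (cNorm_κ)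
open B6RandomWalkHom (HasMajorantHom hasMajorantHom_mono)
open B9CoReadingCoordsH (blkHK)

variable {N : ℕ} {d ℓ : ℕ} {hd : 1 ≤ d + 1} {hL : Odd (ℓ + 1) ∧ 1 < ℓ + 1} {b₀ b₁ : ℝ} {Mstar : ℕ}

set_option maxHeartbeats 800000 in
/-- ★★★ **THE STEPS AND THE ONE-STEP PAIRS OVER 𝔖₂ AND 𝔖₁ AT THE PINS** (module docstring), member-uniformly in `x`, for `M ≥ M_T`, `Mα₀ ≤ a₀`, U ∈ (3.35)–(3.36).
[cite: Balaban1985BackgroundPropagators, Thm 3.12 p.423, (3.130)–(3.131) pp.421–422, (3.137)–(3.138) p.423, Thm 3.3 p.399, (3.42)–(3.45) pp.397–398, p.398 (remark after (3.47));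
Balaban1984PropagatorsII, (2.54) p.233, Lemma 2.1 (2.60)–(2.61) p.234] -/
theorem hStatePairs_of_pinsP_geo9Y_J [NeZero N] [∀ x : MemberY d ℓ hd hL b₀ b₁ Mstar, Fintype (geo9Y x).Site]
    {R₁ R₂ : RegFamY d ℓ hd hL b₀ b₁ Mstar (Matrix (Fin N) (Fin N) ℂ)} (H : MemberY d ℓ hd hL b₀ b₁ Mstar → Prop) {J : Type} (f : J → MemberY d ℓ hd hL b₀ b₁ Mstar)
    (bI : ∀ x : MemberY d ℓ hd hL b₀ b₁ Mstar, FBondY x.toKIdx → IBondY x.toKIdx)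
    (hlev : ∀ (x : MemberY d ℓ hd hL b₀ b₁ Mstar) (f : FBondY x.toKIdx), lvl x.hN x.D x.hk (bI x f) = (blkV1 x.hN x.D f).1.1)
    (hβ1 : ∀ (x : MemberY d ℓ hd hL b₀ b₁ Mstar) (f : FBondY x.toKIdx), (geomT x.D).dist (β x.hN x.D x.hk (bI x f)) (blkV1 x.hN x.D f) ≤ 1)
    (c : ℝ) {M₀ a₀ : ℝ} (hM₀ : 0 ≤ M₀) {σ τ : ℝ} (hσ : 0 < σ) (hτ : 0 < τ)
    (w13 : ℝ → ℝ) (hw13₀ : ∀ s, 0 ≤ w13 s) (hw13₁ : ∀ s, w13 s ≤ 1)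
    (bH13 : ∀ x : MemberY d ℓ hd hL b₀ b₁ Mstar, (bg9YR (Matrix (Fin N) (Fin N) ℂ) (specialUnitaryUnits (Fin N)) R₁ R₂ x).Cfg → BlockNorm (toB6 (geo9Y x) 1 (H x)) (XSK (TrIdx N) x.toKIdx → ℝ))
    (hbH13 : ∀ (x : MemberY d ℓ hd hL b₀ b₁ Mstar) (U : (bg9YR (Matrix (Fin N) (Fin N) ℂ) (specialUnitaryUnits (Fin N)) R₁ R₂ x).Cfg), bH13 x U =
      letI : Fintype (geo9K x.toKIdx).Site := (inferInstance : Fintype (geo9Y x).Site);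
      bHZPG (κ := TrIdx N) x.toKIdx (trBasis N) (taxiS x.toKIdx (bg9YR (Matrix (Fin N) (Fin N) ℂ) (specialUnitaryUnits (Fin N)) R₁ R₂ x) (fun U => U) U) (R := (1 : ℝ)) (H := H x) w13 hw13₀ hw13₁)
    (hκ13 : ∀ (x : MemberY d ℓ hd hL b₀ b₁ Mstar) (U : (bg9YR (Matrix (Fin N) (Fin N) ℂ) (specialUnitaryUnits (Fin N)) R₁ R₂ x).Cfg), (bH13 x U).κ ≤ 1 + CLip d ℓ)
    (bXH : ∀ x : MemberY d ℓ hd hL b₀ b₁ Mstar, (bg9YR (Matrix (Fin N) (Fin N) ℂ) (specialUnitaryUnits (Fin N)) R₁ R₂ x).Cfg → BlockNorm (toB6 (geo9Y x) 1 (H x)) (XBK (TrIdx N) x.toKIdx → ℝ))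
    {s44 : ℝ} (hs440 : 0 < s44) (hs441 : s44 < 1) (hw1344 : 0 < w13 s44)
    (𝔬12 : ∀ x : MemberY d ℓ hd hL b₀ b₁ Mstar, B9Thm312Whole.Ops (geo9Y x) (bg9YR (Matrix (Fin N) (Fin N) ℂ) (specialUnitaryUnits (Fin N)) R₁ R₂ x) (XBK (TrIdx N) x.toKIdx) (XBK (TrIdx N) x.toKIdx) (XHK (TrIdx N) x.toKIdx) (XSK (TrIdx N) x.toKIdx))
    (hblkW12 : ∀ x : MemberY d ℓ hd hL b₀ b₁ Mstar, (𝔬12 x).blkW = blkSK x.toKIdx (sIK x.toKIdx (bI x)))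
    {PX PY : MemberY d ℓ hd hL b₀ b₁ Mstar → Type} [∀ x, Fintype (PX x)] [∀ x, Fintype (PY x)]
    (𝔭A : ∀ x : MemberY d ℓ hd hL b₀ b₁ Mstar, HolderProbes (geo9Y x) (bg9YR (Matrix (Fin N) (Fin N) ℂ) (specialUnitaryUnits (Fin N)) R₁ R₂ x) (XBK (TrIdx N) x.toKIdx) (XBK (TrIdx N) x.toKIdx) (PX x) (PY x))
    (Dd : ∀ x : MemberY d ℓ hd hL b₀ b₁ Mstar, (bg9YR (Matrix (Fin N) (Fin N) ℂ) (specialUnitaryUnits (Fin N)) R₁ R₂ x).Cfg → Fin (d + 1) → Module.End ℝ (XBK (TrIdx N) x.toKIdx → ℝ))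
    -- the state letters' free letters (STEP 1 instantiates them with the coordinate split letters)
    (Ta Ta₂ : ∀ x : MemberY d ℓ hd hL b₀ b₁ Mstar, (bg9YR (Matrix (Fin N) (Fin N) ℂ) (specialUnitaryUnits (Fin N)) R₁ R₂ x).Cfg → Module.End ℝ (XBK (TrIdx N) x.toKIdx → ℝ))
    (Tb Tb₂ : ∀ x : MemberY d ℓ hd hL b₀ b₁ Mstar, (bg9YR (Matrix (Fin N) (Fin N) ℂ) (specialUnitaryUnits (Fin N)) R₁ R₂ x).Cfg → (XBK (TrIdx N) x.toKIdx → ℝ) →ₗ[ℝ] (XSK (TrIdx N) x.toKIdx → ℝ))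
    -- numerics
    {tS δS A₀ AW' δP B12₀ δ12₀ B₃ δ₃ cX0 δ12₃ ρ : ℝ} {Bh12 BhD BdX Bx13 : ℝ → ℝ}
    (htS : 0 ≤ tS) (hA₀ : 0 ≤ A₀) (hAW : 0 ≤ AW') (hB12₀ : 0 ≤ B12₀) (hB₃ : 0 ≤ B₃) (hcX0 : 0 ≤ cX0)
    (hBh12 : ∀ β, 0 ≤ β → β < 1 → 0 ≤ Bh12 β) (hBhD : ∀ β, 0 ≤ β → β < 1 → 0 ≤ BhD β) (hBdX : ∀ β, 0 ≤ β → β < 1 → 0 ≤ BdX β) (hBx13 : ∀ β, 0 ≤ β → β < 1 → 0 ≤ Bx13 β)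
    (hρ : 0 ≤ ρ) (hρT : ρ ≤ δS) (hρ0 : ρ + σ ≤ δ12₀) (hρ3 : ρ + σ ≤ δ₃) (hρP : ρ + σ ≤ δP) (hρX : ρ + 2 * σ + τ ≤ δ12₃)
    -- the inputs
    (hLS : ∀ j : J, M₀ ≤ (geo9Y (f j)).M → ∀ α₀ : ℝ, 0 < α₀ → (geo9Y (f j)).M * α₀ ≤ a₀ → ∀ U : (bg9YR (Matrix (Fin N) (Fin N) ℂ) (specialUnitaryUnits (Fin N)) R₁ R₂ (f j)).Cfg, (bg9YR (Matrix (Fin N) (Fin N) ℂ) (specialUnitaryUnits (Fin N)) R₁ R₂ (f j)).Reg335 c α₀ U → (bg9YR (Matrix (Fin N) (Fin N) ℂ) (specialUnitaryUnits (Fin N)) R₁ R₂ (f j)).Reg336 c α₀ U →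
      LettersS3131 (𝔬12 (f j)) (Ta (f j)) (Ta₂ (f j)) (Tb (f j)) (Tb₂ (f j)) 1 (H (f j)) (fun y => (geo9Y_len_pos (f j) y).le) (weightNorm (bXH (f j) U) (rwt (geo9Y (f j)) (-1)) (rwt_nonneg (fun y => (geo9Y_len_pos (f j) y).le) (-1))) (bH13 (f j) U) (tS * ((geo9Y (f j)).M * α₀)) δS U)
    (hPG0 : ∀ x : MemberY d ℓ hd hL b₀ b₁ Mstar, M₀ ≤ (geo9Y x).M → ∀ α₀ : ℝ, 0 < α₀ → (geo9Y x).M * α₀ ≤ a₀ → ∀ U : (bg9YR (Matrix (Fin N) (Fin N) ℂ) (specialUnitaryUnits (Fin N)) R₁ R₂ x).Cfg, (bg9YR (Matrix (Fin N) (Fin N) ℂ) (specialUnitaryUnits (Fin N)) R₁ R₂ x).Reg335 c α₀ U → (bg9YR (Matrix (Fin N) (Fin N) ℂ) (specialUnitaryUnits (Fin N)) R₁ R₂ x).Reg336 c α₀ U →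
      HasMaj (cNorm 1 (H x) (𝔬12 x).blk (fun y => (geo9Y_len_pos x y).le) 0) (weightNorm (bXH x U) (rwt (geo9Y x) (-1)) (rwt_nonneg (fun y => (geo9Y_len_pos x y).le) (-1))) ((𝔬12 x).G0 U) (fun a b => A₀ * Real.exp (-(δP * (geo9Y x).dist a b))))
    (hPGD : ∀ x : MemberY d ℓ hd hL b₀ b₁ Mstar, M₀ ≤ (geo9Y x).M → ∀ α₀ : ℝ, 0 < α₀ → (geo9Y x).M * α₀ ≤ a₀ → ∀ U : (bg9YR (Matrix (Fin N) (Fin N) ℂ) (specialUnitaryUnits (Fin N)) R₁ R₂ x).Cfg, (bg9YR (Matrix (Fin N) (Fin N) ℂ) (specialUnitaryUnits (Fin N)) R₁ R₂ x).Reg335 c α₀ U → (bg9YR (Matrix (Fin N) (Fin N) ℂ) (specialUnitaryUnits (Fin N)) R₁ R₂ x).Reg336 c α₀ U →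
      HasMaj (bH13 x U) (weightNorm (bXH x U) (rwt (geo9Y x) (-1)) (rwt_nonneg (fun y => (geo9Y_len_pos x y).le) (-1))) ((𝔬12 x).G0 U ∘ₗ (𝔬12 x).Dv U) (fun a b => AW' * Real.exp (-(δP * (geo9Y x).dist a b))))
    (he1 : ∀ x : MemberY d ℓ hd hL b₀ b₁ Mstar, M₀ ≤ (geo9Y x).M → ∀ α₀ : ℝ, 0 < α₀ → (geo9Y x).M * α₀ ≤ a₀ → ∀ U : (bg9YR (Matrix (Fin N) (Fin N) ℂ) (specialUnitaryUnits (Fin N)) R₁ R₂ x).Cfg, (bg9YR (Matrix (Fin N) (Fin N) ℂ) (specialUnitaryUnits (Fin N)) R₁ R₂ x).Reg335 c α₀ U → (bg9YR (Matrix (Fin N) (Fin N) ℂ) (specialUnitaryUnits (Fin N)) R₁ R₂ x).Reg336 c α₀ U →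
      HasMajorantHom (g := toB6 (geo9Y x) 1 (H x)) (𝔬12 x).blk (𝔬12 x).blkY ((𝔬12 x).D U ∘ₗ (𝔬12 x).G0 U) (fun (a b : (geo9Y x).Site) => B12₀ * (geo9Y x).len a * Real.exp (-(δ12₀ * (geo9Y x).dist a b))))
    (he1d : ∀ x : MemberY d ℓ hd hL b₀ b₁ Mstar, M₀ ≤ (geo9Y x).M → ∀ α₀ : ℝ, 0 < α₀ → (geo9Y x).M * α₀ ≤ a₀ → ∀ U : (bg9YR (Matrix (Fin N) (Fin N) ℂ) (specialUnitaryUnits (Fin N)) R₁ R₂ x).Cfg, (bg9YR (Matrix (Fin N) (Fin N) ℂ) (specialUnitaryUnits (Fin N)) R₁ R₂ x).Reg335 c α₀ U → (bg9YR (Matrix (Fin N) (Fin N) ℂ) (specialUnitaryUnits (Fin N)) R₁ R₂ x).Reg336 c α₀ U → ∀ ν : Fin (d + 1),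
      HasMajorantHom (g := toB6 (geo9Y x) 1 (H x)) (𝔬12 x).blk (𝔬12 x).blk (Dd x U ν ∘ₗ (𝔬12 x).G0 U) (fun (a b : (geo9Y x).Site) => B12₀ * (geo9Y x).len a * Real.exp (-(δ12₀ * (geo9Y x).dist a b))))
    (h43L : ∀ x : MemberY d ℓ hd hL b₀ b₁ Mstar, M₀ ≤ (geo9Y x).M → ∀ α₀ : ℝ, 0 < α₀ → (geo9Y x).M * α₀ ≤ a₀ → ∀ U : (bg9YR (Matrix (Fin N) (Fin N) ℂ) (specialUnitaryUnits (Fin N)) R₁ R₂ x).Cfg, (bg9YR (Matrix (Fin N) (Fin N) ℂ) (specialUnitaryUnits (Fin N)) R₁ R₂ x).Reg335 c α₀ U → (bg9YR (Matrix (Fin N) (Fin N) ℂ) (specialUnitaryUnits (Fin N)) R₁ R₂ x).Reg336 c α₀ U → ∀ β : ℝ, 0 ≤ β → β < 1 →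
      HasMajorantHom (g := toB6 (geo9Y x) 1 (H x)) (𝔬12 x).blk (𝔭A x).blkPY ((𝔭A x).ΦY U β ∘ₗ ((𝔬12 x).D U ∘ₗ (𝔬12 x).G0 U)) (fun (a b : (geo9Y x).Site) => Bh12 β * (geo9Y x).len a ^ (1 - β) * Real.exp (-(δ12₀ * (geo9Y x).dist a b))))
    (h43d : ∀ x : MemberY d ℓ hd hL b₀ b₁ Mstar, M₀ ≤ (geo9Y x).M → ∀ α₀ : ℝ, 0 < α₀ → (geo9Y x).M * α₀ ≤ a₀ → ∀ U : (bg9YR (Matrix (Fin N) (Fin N) ℂ) (specialUnitaryUnits (Fin N)) R₁ R₂ x).Cfg, (bg9YR (Matrix (Fin N) (Fin N) ℂ) (specialUnitaryUnits (Fin N)) R₁ R₂ x).Reg335 c α₀ U → (bg9YR (Matrix (Fin N) (Fin N) ℂ) (specialUnitaryUnits (Fin N)) R₁ R₂ x).Reg336 c α₀ U → ∀ (ν : Fin (d + 1)) (β : ℝ), 0 ≤ β → β < 1 →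
      HasMajorantHom (g := toB6 (geo9Y x) 1 (H x)) (𝔬12 x).blk (𝔭A x).blkPX ((𝔭A x).ΦX U β ∘ₗ (Dd x U ν ∘ₗ (𝔬12 x).G0 U)) (fun (a b : (geo9Y x).Site) => Bh12 β * (geo9Y x).len a ^ (1 - β) * Real.exp (-(δ12₀ * (geo9Y x).dist a b))))
    (hpX0 : ∀ x : MemberY d ℓ hd hL b₀ b₁ Mstar, M₀ ≤ (geo9Y x).M → ∀ α₀ : ℝ, 0 < α₀ → (geo9Y x).M * α₀ ≤ a₀ → ∀ U : (bg9YR (Matrix (Fin N) (Fin N) ℂ) (specialUnitaryUnits (Fin N)) R₁ R₂ x).Cfg, (bg9YR (Matrix (Fin N) (Fin N) ℂ) (specialUnitaryUnits (Fin N)) R₁ R₂ x).Reg335 c α₀ U → (bg9YR (Matrix (Fin N) (Fin N) ℂ) (specialUnitaryUnits (Fin N)) R₁ R₂ x).Reg336 c α₀ U → ∀ β : ℝ, 0 ≤ β → β < 1 →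
      HasMaj (cNormR 1 (H x) (𝔬12 x).blk (fun y => (geo9Y_len_pos x y).le) 0) (cNormR 1 (H x) (𝔭A x).blkPX (fun y => (geo9Y_len_pos x y).le) (β - 2)) ((𝔭A x).ΦX U β ∘ₗ (𝔬12 x).G0 U) (fun a b => cX0 * Real.exp (-(δ12₀ * (geo9Y x).dist a b))))
    (hdgDH : ∀ x : MemberY d ℓ hd hL b₀ b₁ Mstar, M₀ ≤ (geo9Y x).M → ∀ α₀ : ℝ, 0 < α₀ → (geo9Y x).M * α₀ ≤ a₀ → ∀ U : (bg9YR (Matrix (Fin N) (Fin N) ℂ) (specialUnitaryUnits (Fin N)) R₁ R₂ x).Cfg, (bg9YR (Matrix (Fin N) (Fin N) ℂ) (specialUnitaryUnits (Fin N)) R₁ R₂ x).Reg335 c α₀ U → (bg9YR (Matrix (Fin N) (Fin N) ℂ) (specialUnitaryUnits (Fin N)) R₁ R₂ x).Reg336 c α₀ U →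
      HasMaj (bH13 x U) (cNorm 1 (H x) (𝔬12 x).blkY (fun y => (geo9Y_len_pos x y).le) 1) ((𝔬12 x).D U ∘ₗ (𝔬12 x).G0 U ∘ₗ (𝔬12 x).Dv U) (fun a a' => B₃ * Real.exp (-(δ₃ * (geo9Y x).dist a a'))))
    (hdgDHd : ∀ x : MemberY d ℓ hd hL b₀ b₁ Mstar, M₀ ≤ (geo9Y x).M → ∀ α₀ : ℝ, 0 < α₀ → (geo9Y x).M * α₀ ≤ a₀ → ∀ U : (bg9YR (Matrix (Fin N) (Fin N) ℂ) (specialUnitaryUnits (Fin N)) R₁ R₂ x).Cfg, (bg9YR (Matrix (Fin N) (Fin N) ℂ) (specialUnitaryUnits (Fin N)) R₁ R₂ x).Reg335 c α₀ U → (bg9YR (Matrix (Fin N) (Fin N) ℂ) (specialUnitaryUnits (Fin N)) R₁ R₂ x).Reg336 c α₀ U → ∀ ν : Fin (d + 1),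
      HasMaj (bH13 x U) (cNorm 1 (H x) (𝔬12 x).blk (fun y => (geo9Y_len_pos x y).le) 1) (Dd x U ν ∘ₗ (𝔬12 x).G0 U ∘ₗ (𝔬12 x).Dv U) (fun a a' => B₃ * Real.exp (-(δ₃ * (geo9Y x).dist a a'))))
    (hYd : ∀ x : MemberY d ℓ hd hL b₀ b₁ Mstar, M₀ ≤ (geo9Y x).M → ∀ α₀ : ℝ, 0 < α₀ → (geo9Y x).M * α₀ ≤ a₀ → ∀ U : (bg9YR (Matrix (Fin N) (Fin N) ℂ) (specialUnitaryUnits (Fin N)) R₁ R₂ x).Cfg, (bg9YR (Matrix (Fin N) (Fin N) ℂ) (specialUnitaryUnits (Fin N)) R₁ R₂ x).Reg335 c α₀ U → (bg9YR (Matrix (Fin N) (Fin N) ℂ) (specialUnitaryUnits (Fin N)) R₁ R₂ x).Reg336 c α₀ U → ∀ β : ℝ, 0 ≤ β → β < 1 →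
      HasMaj (bH13 x U) (cNormR 1 (H x) (𝔭A x).blkPY (fun y => (geo9Y_len_pos x y).le) (β - 1)) (((𝔭A x).ΦY U β ∘ₗ (𝔬12 x).D U ∘ₗ (𝔬12 x).G0 U) ∘ₗ (𝔬12 x).Dv U) (fun a a' => BhD β * Real.exp (-(δ₃ * (geo9Y x).dist a a'))))
    (hXd : ∀ x : MemberY d ℓ hd hL b₀ b₁ Mstar, M₀ ≤ (geo9Y x).M → ∀ α₀ : ℝ, 0 < α₀ → (geo9Y x).M * α₀ ≤ a₀ → ∀ U : (bg9YR (Matrix (Fin N) (Fin N) ℂ) (specialUnitaryUnits (Fin N)) R₁ R₂ x).Cfg, (bg9YR (Matrix (Fin N) (Fin N) ℂ) (specialUnitaryUnits (Fin N)) R₁ R₂ x).Reg335 c α₀ U → (bg9YR (Matrix (Fin N) (Fin N) ℂ) (specialUnitaryUnits (Fin N)) R₁ R₂ x).Reg336 c α₀ U → ∀ (ν : Fin (d + 1)) (β : ℝ), 0 ≤ β → β < 1 →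
      HasMaj (bH13 x U) (cNormR 1 (H x) (𝔭A x).blkPX (fun y => (geo9Y_len_pos x y).le) (β - 1)) (((𝔭A x).ΦX U β ∘ₗ Dd x U ν ∘ₗ (𝔬12 x).G0 U) ∘ₗ (𝔬12 x).Dv U) (fun a a' => BdX β * Real.exp (-(δ₃ * (geo9Y x).dist a a'))))
    (hpXDv : ∀ x : MemberY d ℓ hd hL b₀ b₁ Mstar, M₀ ≤ (geo9Y x).M → ∀ α₀ : ℝ, 0 < α₀ → (geo9Y x).M * α₀ ≤ a₀ → ∀ U : (bg9YR (Matrix (Fin N) (Fin N) ℂ) (specialUnitaryUnits (Fin N)) R₁ R₂ x).Cfg, (bg9YR (Matrix (Fin N) (Fin N) ℂ) (specialUnitaryUnits (Fin N)) R₁ R₂ x).Reg335 c α₀ U → (bg9YR (Matrix (Fin N) (Fin N) ℂ) (specialUnitaryUnits (Fin N)) R₁ R₂ x).Reg336 c α₀ U → ∀ β : ℝ, 0 ≤ β → β < 1 →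
      HasMaj (cNormR 1 (H x) (𝔬12 x).blkW (fun y => (geo9Y_len_pos x y).le) 0) (cNormR 1 (H x) (𝔭A x).blkPX (fun y => (geo9Y_len_pos x y).le) (β - 1)) (((𝔭A x).ΦX U β ∘ₗ (𝔬12 x).G0 U) ∘ₗ (𝔬12 x).Dv U) (fun a b => Bx13 β * Real.exp (-(δ12₃ * (geo9Y x).dist a b)))) :
    ∃ MT : ℝ, ∀ j : J, MT ≤ (geo9Y (f j)).M → ∀ α₀ : ℝ, 0 < α₀ → (geo9Y (f j)).M * α₀ ≤ a₀ → ∀ U : (bg9YR (Matrix (Fin N) (Fin N) ℂ) (specialUnitaryUnits (Fin N)) R₁ R₂ (f j)).Cfg, (bg9YR (Matrix (Fin N) (Fin N) ℂ) (specialUnitaryUnits (Fin N)) R₁ R₂ (f j)).Reg335 c α₀ U → (bg9YR (Matrix (Fin N) (Fin N) ℂ) (specialUnitaryUnits (Fin N)) R₁ R₂ (f j)).Reg336 c α₀ U →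
      -- the steps on 𝔖₂ (rate ρ) and 𝔖₁ (rate ρ − τ)
      StepS (𝔬12 (f j)) (weightNorm (bXH (f j) U) (rwt (geo9Y (f j)) (-1)) (rwt_nonneg (fun y => (geo9Y_len_pos (f j) y).le) (-1))) (2 * ((A₀ + (1 + CLip d ℓ) * AW') * tS * rowConst261 (@geo9Y d ℓ hd hL b₀ b₁ Mstar) σ) * ((geo9Y (f j)).M * α₀)) ρ U ∧
      StepS (𝔬12 (f j)) (bXH (f j) U) (2 * ((A₀ + (1 + CLip d ℓ) * AW') * tS * rowConst261 (@geo9Y d ℓ hd hL b₀ b₁ Mstar) σ) * (((ℓ + 1 : ℕ) : ℝ)) * ((geo9Y (f j)).M * α₀)) (ρ - τ) U ∧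
      -- ∇_UG₀T : 𝔖₂ → 𝔠_Y⁽¹⁾ (both T)
      (HasMaj (weightNorm (bXH (f j) U) (rwt (geo9Y (f j)) (-1)) (rwt_nonneg (fun y => (geo9Y_len_pos (f j) y).le) (-1))) (cNorm 1 (H (f j)) (𝔬12 (f j)).blkY (fun y => (geo9Y_len_pos (f j) y).le) 1) ((𝔬12 (f j)).D U ∘ₗ (𝔬12 (f j)).G0 U ∘ₗ (𝔬12 (f j)).Tpi U) (fun a b => 2 * ((B12₀ + (1 + CLip d ℓ) * B₃) * tS * rowConst261 (@geo9Y d ℓ hd hL b₀ b₁ Mstar) σ) * ((geo9Y (f j)).M * α₀) * Real.exp (-(ρ * (geo9Y (f j)).dist a b))) ∧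
        HasMaj (weightNorm (bXH (f j) U) (rwt (geo9Y (f j)) (-1)) (rwt_nonneg (fun y => (geo9Y_len_pos (f j) y).le) (-1))) (cNorm 1 (H (f j)) (𝔬12 (f j)).blkY (fun y => (geo9Y_len_pos (f j) y).le) 1) ((𝔬12 (f j)).D U ∘ₗ (𝔬12 (f j)).G0 U ∘ₗ ((𝔬12 (f j)).Tpi U + (𝔬12 (f j)).T2 U)) (fun a b => 2 * ((B12₀ + (1 + CLip d ℓ) * B₃) * tS * rowConst261 (@geo9Y d ℓ hd hL b₀ b₁ Mstar) σ) * ((geo9Y (f j)).M * α₀) * Real.exp (-(ρ * (geo9Y (f j)).dist a b)))) ∧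
      -- ∇_{U,ν}G₀T : 𝔖₂ → 𝔠⁽¹⁾ and 𝔖₁ → 𝔠^{(0)} (both T)
      (∀ ν : Fin (d + 1),
        (HasMaj (weightNorm (bXH (f j) U) (rwt (geo9Y (f j)) (-1)) (rwt_nonneg (fun y => (geo9Y_len_pos (f j) y).le) (-1))) (cNorm 1 (H (f j)) (𝔬12 (f j)).blk (fun y => (geo9Y_len_pos (f j) y).le) 1) (Dd (f j) U ν ∘ₗ (𝔬12 (f j)).G0 U ∘ₗ (𝔬12 (f j)).Tpi U) (fun a b => 2 * ((B12₀ + (1 + CLip d ℓ) * B₃) * tS * rowConst261 (@geo9Y d ℓ hd hL b₀ b₁ Mstar) σ) * ((geo9Y (f j)).M * α₀) * Real.exp (-(ρ * (geo9Y (f j)).dist a b))) ∧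
          HasMaj (weightNorm (bXH (f j) U) (rwt (geo9Y (f j)) (-1)) (rwt_nonneg (fun y => (geo9Y_len_pos (f j) y).le) (-1))) (cNorm 1 (H (f j)) (𝔬12 (f j)).blk (fun y => (geo9Y_len_pos (f j) y).le) 1) (Dd (f j) U ν ∘ₗ (𝔬12 (f j)).G0 U ∘ₗ ((𝔬12 (f j)).Tpi U + (𝔬12 (f j)).T2 U)) (fun a b => 2 * ((B12₀ + (1 + CLip d ℓ) * B₃) * tS * rowConst261 (@geo9Y d ℓ hd hL b₀ b₁ Mstar) σ) * ((geo9Y (f j)).M * α₀) * Real.exp (-(ρ * (geo9Y (f j)).dist a b)))) ∧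
        (HasMaj (bXH (f j) U) (cNormR 1 (H (f j)) (𝔬12 (f j)).blk (fun y => (geo9Y_len_pos (f j) y).le) 0) (Dd (f j) U ν ∘ₗ (𝔬12 (f j)).G0 U ∘ₗ (𝔬12 (f j)).Tpi U) (fun a b => 2 * ((B12₀ + (1 + CLip d ℓ) * B₃) * tS * rowConst261 (@geo9Y d ℓ hd hL b₀ b₁ Mstar) σ) * ((geo9Y (f j)).M * α₀) * (geo9Y (f j)).L * Real.exp (-((ρ - τ) * (geo9Y (f j)).dist a b))) ∧
          HasMaj (bXH (f j) U) (cNormR 1 (H (f j)) (𝔬12 (f j)).blk (fun y => (geo9Y_len_pos (f j) y).le) 0) (Dd (f j) U ν ∘ₗ (𝔬12 (f j)).G0 U ∘ₗ ((𝔬12 (f j)).Tpi U + (𝔬12 (f j)).T2 U)) (fun a b => 2 * ((B12₀ + (1 + CLip d ℓ) * B₃) * tS * rowConst261 (@geo9Y d ℓ hd hL b₀ b₁ Mstar) σ) * ((geo9Y (f j)).M * α₀) * (geo9Y (f j)).L * Real.exp (-((ρ - τ) * (geo9Y (f j)).dist a b))))) ∧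
      -- Φ^Y_β∇_UG₀T : 𝔖₂ → 𝔠_PY^{(β−1)} (both T)
      (∀ β : ℝ, 0 ≤ β → β < 1 →
        HasMaj (weightNorm (bXH (f j) U) (rwt (geo9Y (f j)) (-1)) (rwt_nonneg (fun y => (geo9Y_len_pos (f j) y).le) (-1))) (cNormR 1 (H (f j)) (𝔭A (f j)).blkPY (fun y => (geo9Y_len_pos (f j) y).le) (β - 1)) (((𝔭A (f j)).ΦY U β ∘ₗ (𝔬12 (f j)).D U ∘ₗ (𝔬12 (f j)).G0 U) ∘ₗ (𝔬12 (f j)).Tpi U) (fun a b => 2 * ((Bh12 β + (1 + CLip d ℓ) * BhD β) * tS * rowConst261 (@geo9Y d ℓ hd hL b₀ b₁ Mstar) σ) * ((geo9Y (f j)).M * α₀) * Real.exp (-(ρ * (geo9Y (f j)).dist a b))) ∧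
        HasMaj (weightNorm (bXH (f j) U) (rwt (geo9Y (f j)) (-1)) (rwt_nonneg (fun y => (geo9Y_len_pos (f j) y).le) (-1))) (cNormR 1 (H (f j)) (𝔭A (f j)).blkPY (fun y => (geo9Y_len_pos (f j) y).le) (β - 1)) (((𝔭A (f j)).ΦY U β ∘ₗ (𝔬12 (f j)).D U ∘ₗ (𝔬12 (f j)).G0 U) ∘ₗ ((𝔬12 (f j)).Tpi U + (𝔬12 (f j)).T2 U)) (fun a b => 2 * ((Bh12 β + (1 + CLip d ℓ) * BhD β) * tS * rowConst261 (@geo9Y d ℓ hd hL b₀ b₁ Mstar) σ) * ((geo9Y (f j)).M * α₀) * Real.exp (-(ρ * (geo9Y (f j)).dist a b)))) ∧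
      -- Φ^X_β∇_{U,ν}G₀T : 𝔖₂ → 𝔠_PX^{(β−1)} and 𝔖₁ → 𝔠_PX^{(β)} (both T)
      (∀ (ν : Fin (d + 1)) (β : ℝ), 0 ≤ β → β < 1 →
        (HasMaj (weightNorm (bXH (f j) U) (rwt (geo9Y (f j)) (-1)) (rwt_nonneg (fun y => (geo9Y_len_pos (f j) y).le) (-1))) (cNormR 1 (H (f j)) (𝔭A (f j)).blkPX (fun y => (geo9Y_len_pos (f j) y).le) (β - 1)) (((𝔭A (f j)).ΦX U β ∘ₗ Dd (f j) U ν ∘ₗ (𝔬12 (f j)).G0 U) ∘ₗ (𝔬12 (f j)).Tpi U) (fun a b => 2 * ((Bh12 β + (1 + CLip d ℓ) * BdX β) * tS * rowConst261 (@geo9Y d ℓ hd hL b₀ b₁ Mstar) σ) * ((geo9Y (f j)).M * α₀) * Real.exp (-(ρ * (geo9Y (f j)).dist a b))) ∧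
          HasMaj (weightNorm (bXH (f j) U) (rwt (geo9Y (f j)) (-1)) (rwt_nonneg (fun y => (geo9Y_len_pos (f j) y).le) (-1))) (cNormR 1 (H (f j)) (𝔭A (f j)).blkPX (fun y => (geo9Y_len_pos (f j) y).le) (β - 1)) (((𝔭A (f j)).ΦX U β ∘ₗ Dd (f j) U ν ∘ₗ (𝔬12 (f j)).G0 U) ∘ₗ ((𝔬12 (f j)).Tpi U + (𝔬12 (f j)).T2 U)) (fun a b => 2 * ((Bh12 β + (1 + CLip d ℓ) * BdX β) * tS * rowConst261 (@geo9Y d ℓ hd hL b₀ b₁ Mstar) σ) * ((geo9Y (f j)).M * α₀) * Real.exp (-(ρ * (geo9Y (f j)).dist a b)))) ∧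
        (HasMaj (bXH (f j) U) (cNormR 1 (H (f j)) (𝔭A (f j)).blkPX (fun y => (geo9Y_len_pos (f j) y).le) β) (((𝔭A (f j)).ΦX U β ∘ₗ Dd (f j) U ν ∘ₗ (𝔬12 (f j)).G0 U) ∘ₗ (𝔬12 (f j)).Tpi U) (fun a b => 2 * ((Bh12 β + (1 + CLip d ℓ) * BdX β) * tS * rowConst261 (@geo9Y d ℓ hd hL b₀ b₁ Mstar) σ) * ((geo9Y (f j)).M * α₀) * (geo9Y (f j)).L * Real.exp (-((ρ - τ) * (geo9Y (f j)).dist a b))) ∧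
          HasMaj (bXH (f j) U) (cNormR 1 (H (f j)) (𝔭A (f j)).blkPX (fun y => (geo9Y_len_pos (f j) y).le) β) (((𝔭A (f j)).ΦX U β ∘ₗ Dd (f j) U ν ∘ₗ (𝔬12 (f j)).G0 U) ∘ₗ ((𝔬12 (f j)).Tpi U + (𝔬12 (f j)).T2 U)) (fun a b => 2 * ((Bh12 β + (1 + CLip d ℓ) * BdX β) * tS * rowConst261 (@geo9Y d ℓ hd hL b₀ b₁ Mstar) σ) * ((geo9Y (f j)).M * α₀) * (geo9Y (f j)).L * Real.exp (-((ρ - τ) * (geo9Y (f j)).dist a b))))) ∧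
      -- Φ^X_βG₀T : 𝔖₂ → 𝔠_PX^{(β−2)} and 𝔖₁ → 𝔠_PX^{(β−1)} (both T)
      (∀ β : ℝ, 0 ≤ β → β < 1 →
        (HasMaj (weightNorm (bXH (f j) U) (rwt (geo9Y (f j)) (-1)) (rwt_nonneg (fun y => (geo9Y_len_pos (f j) y).le) (-1))) (cNormR 1 (H (f j)) (𝔭A (f j)).blkPX (fun y => (geo9Y_len_pos (f j) y).le) (β - 2)) (((𝔭A (f j)).ΦX U β ∘ₗ (𝔬12 (f j)).G0 U) ∘ₗ (𝔬12 (f j)).Tpi U) (fun a b => 2 * ((cX0 + (1 + CLip d ℓ) * (1 * (Bx13 β * (((ℓ + 1 : ℕ) : ℝ))) * ((w13 s44)⁻¹ * ((((ℓ + 1 : ℕ) : ℝ)) * Real.exp ((δ12₃ - τ) * (rNear d ℓ + 1)))) * rowConst261 (@geo9Y d ℓ hd hL b₀ b₁ Mstar) σ)) * tS * rowConst261 (@geo9Y d ℓ hd hL b₀ b₁ Mstar) σ) * ((geo9Y (f j)).M * α₀) * Real.exp (-(ρ * (geo9Y (f j)).dist a b))) ∧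
          HasMaj (weightNorm (bXH (f j) U) (rwt (geo9Y (f j)) (-1)) (rwt_nonneg (fun y => (geo9Y_len_pos (f j) y).le) (-1))) (cNormR 1 (H (f j)) (𝔭A (f j)).blkPX (fun y => (geo9Y_len_pos (f j) y).le) (β - 2)) (((𝔭A (f j)).ΦX U β ∘ₗ (𝔬12 (f j)).G0 U) ∘ₗ ((𝔬12 (f j)).Tpi U + (𝔬12 (f j)).T2 U)) (fun a b => 2 * ((cX0 + (1 + CLip d ℓ) * (1 * (Bx13 β * (((ℓ + 1 : ℕ) : ℝ))) * ((w13 s44)⁻¹ * ((((ℓ + 1 : ℕ) : ℝ)) * Real.exp ((δ12₃ - τ) * (rNear d ℓ + 1)))) * rowConst261 (@geo9Y d ℓ hd hL b₀ b₁ Mstar) σ)) * tS * rowConst261 (@geo9Y d ℓ hd hL b₀ b₁ Mstar) σ) * ((geo9Y (f j)).M * α₀) * Real.exp (-(ρ * (geo9Y (f j)).dist a b)))) ∧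
        (HasMaj (bXH (f j) U) (cNormR 1 (H (f j)) (𝔭A (f j)).blkPX (fun y => (geo9Y_len_pos (f j) y).le) (β - 1)) (((𝔭A (f j)).ΦX U β ∘ₗ (𝔬12 (f j)).G0 U) ∘ₗ (𝔬12 (f j)).Tpi U) (fun a b => 2 * ((cX0 + (1 + CLip d ℓ) * (1 * (Bx13 β * (((ℓ + 1 : ℕ) : ℝ))) * ((w13 s44)⁻¹ * ((((ℓ + 1 : ℕ) : ℝ)) * Real.exp ((δ12₃ - τ) * (rNear d ℓ + 1)))) * rowConst261 (@geo9Y d ℓ hd hL b₀ b₁ Mstar) σ)) * tS * rowConst261 (@geo9Y d ℓ hd hL b₀ b₁ Mstar) σ) * ((geo9Y (f j)).M * α₀) * (geo9Y (f j)).L * Real.exp (-((ρ - τ) * (geo9Y (f j)).dist a b))) ∧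
          HasMaj (bXH (f j) U) (cNormR 1 (H (f j)) (𝔭A (f j)).blkPX (fun y => (geo9Y_len_pos (f j) y).le) (β - 1)) (((𝔭A (f j)).ΦX U β ∘ₗ (𝔬12 (f j)).G0 U) ∘ₗ ((𝔬12 (f j)).Tpi U + (𝔬12 (f j)).T2 U)) (fun a b => 2 * ((cX0 + (1 + CLip d ℓ) * (1 * (Bx13 β * (((ℓ + 1 : ℕ) : ℝ))) * ((w13 s44)⁻¹ * ((((ℓ + 1 : ℕ) : ℝ)) * Real.exp ((δ12₃ - τ) * (rNear d ℓ + 1)))) * rowConst261 (@geo9Y d ℓ hd hL b₀ b₁ Mstar) σ)) * tS * rowConst261 (@geo9Y d ℓ hd hL b₀ b₁ Mstar) σ) * ((geo9Y (f j)).M * α₀) * (geo9Y (f j)).L * Real.exp (-((ρ - τ) * (geo9Y (f j)).dist a b))))) := by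
  obtain ⟨Mg, hFa⟩ := facts347_exp261_geo9Y (d := d) (ℓ := ℓ) (hd := hd) (hL := hL) (b₀ := b₀) (b₁ := b₁) (Mstar := Mstar) H (α := 1 / 2) (δ := 2 * τ)
    (by norm_num) (by norm_num) (by linarith)
  obtain ⟨ML, hrow⟩ := rowConst261_spec_of_rowSum261 (rowSum261_geo9Y (d := d) (ℓ := ℓ) (hd := hd) (hL := hL) (b₀ := b₀) (b₁ := b₁) (Mstar := Mstar)) hσ
  have hc0 : (0 : ℝ) ≤ rowConst261 (@geo9Y d ℓ hd hL b₀ b₁ Mstar) σ := rowConst261_nonneg _ _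
  have hτe : (1 : ℝ) / 2 * (2 * τ) = τ := by ring
  refine ⟨max M₀ (max Mg ML), fun j hM α₀ hα ha U hU hU' => ?_⟩
  letI : Fintype (geo9K (f j).toKIdx).Site := (inferInstance : Fintype (geo9Y (f j)).Site)
  have hM0 : M₀ ≤ (geo9Y (f j)).M := (le_max_left _ _).trans hM
  have hFax := hFa (f j) (((le_max_left _ _).trans (le_max_right _ _)).trans hM)
  have hrowx : RowSum (toB6 (geo9Y (f j)) 1 (H (f j))) σ (rowConst261 (@geo9Y d ℓ hd hL b₀ b₁ Mstar) σ) := fun y => hrow (f j) (((le_max_right _ _).trans (le_max_right _ _)).trans hM) y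
  have hG : GeoOK (geo9Y (f j)) := ⟨geo9Y_dist_triangle (f j), geo9Y_dist_comm (f j), geo9K_dist_nonneg (f j).toKIdx, geo9Y_len_pos (f j)⟩
  have htri : B6RandomWalk.Triangle254 (toB6 (geo9Y (f j)) 1 (H (f j))) := fun a b e => hG.tri a b e
  have hcf := abs_cf_eq_nKT (f j).toKIdx (f j).hcfk
  have hNr : ∀ (y : IBondY (f j).toKIdx) (z : SiteY (f j).toKIdx), B9MultiscaleSmoothPartitionY.NearY (f j).toKIdx y z → (geo9K (f j).toKIdx).dist y (sIK (f j).toKIdx (bI (f j)) z) ≤ rNear d ℓ + 1 :=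
    fun y z h => dist_sIK_le_of_nearY (f j).toKIdx (hβ1 (f j)) h
  have hLx : (geo9Y (f j)).L ≤ (((ℓ + 1 : ℕ) : ℝ)) := (geo9Y_scalars (f j)).2.1
  have hL0 : 0 ≤ (geo9Y (f j)).L := le_trans zero_le_one hFax.one_le_L
  have hθ : 0 ≤ ((geo9Y (f j)).M * α₀) := mul_nonneg (hM₀.trans hM0) hα.le
  have ht : 0 ≤ tS * ((geo9Y (f j)).M * α₀) := mul_nonneg htS hθ
  have hκ := hκ13 (f j) U
  have hκ0 : 0 ≤ (bH13 (f j) U).κ := (bH13 (f j) U).κ_nonneg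
  have hK1 : 0 ≤ (1 + CLip d ℓ) := add_nonneg zero_le_one (CLip_nonneg d ℓ)
  have hLSx := hLS j hM0 α₀ hα ha U hU hU'
  -- the common shape of the θ-conditions: `2((a + κ_H·b)·(t_S·Mα₀)·c) ≤ 2((a + (1 + C_Lip)·b)·t_S·c)·Mα₀`
  have hθc : ∀ a b : ℝ, 0 ≤ a → 0 ≤ b → 2 * ((a + (bH13 (f j) U).κ * b) * (tS * ((geo9Y (f j)).M * α₀)) * rowConst261 (@geo9Y d ℓ hd hL b₀ b₁ Mstar) σ) ≤ 2 * ((a + (1 + CLip d ℓ) * b) * tS * rowConst261 (@geo9Y d ℓ hd hL b₀ b₁ Mstar) σ) * ((geo9Y (f j)).M * α₀) := by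
    intro a b ha0 hb0
    have h1 : (a + (bH13 (f j) U).κ * b) * (tS * ((geo9Y (f j)).M * α₀)) * rowConst261 (@geo9Y d ℓ hd hL b₀ b₁ Mstar) σ ≤ (a + (1 + CLip d ℓ) * b) * (tS * ((geo9Y (f j)).M * α₀)) * rowConst261 (@geo9Y d ℓ hd hL b₀ b₁ Mstar) σ :=
      mul_le_mul_of_nonneg_right (mul_le_mul_of_nonneg_right (by nlinarith [mul_le_mul_of_nonneg_right hκ hb0]) ht) hc0
    nlinarith [h1]
  -- (1) the step on 𝔖₂ from the state letters and the two producers; (2) on 𝔖₁ by [4] (2.60)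
  have hS2 : StepS (𝔬12 (f j)) (weightNorm (bXH (f j) U) (rwt (geo9Y (f j)) (-1)) (rwt_nonneg (fun y => (geo9Y_len_pos (f j) y).le) (-1))) (2 * ((A₀ + (1 + CLip d ℓ) * AW') * tS * rowConst261 (@geo9Y d ℓ hd hL b₀ b₁ Mstar) σ) * ((geo9Y (f j)).M * α₀)) ρ U :=
    stepS_of_lettersS hG hrowx hc0 hA₀ hAW ht hρ hρT hρP hρP (hθc A₀ AW' hA₀ hAW) le_rfl (hPG0 (f j) hM0 α₀ hα ha U hU hU') (hPGD (f j) hM0 α₀ hα ha U hU hU') hLSx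
  have hθ20 : 0 ≤ 2 * ((A₀ + (1 + CLip d ℓ) * AW') * tS * rowConst261 (@geo9Y d ℓ hd hL b₀ b₁ Mstar) σ) * ((geo9Y (f j)).M * α₀) := by positivity
  have hS1a := stepS_up hG hFax hθ20 hS2.step
  have hS1b := stepS_up hG hFax hθ20 hS2.step1
  rw [hτe] at hS1a hS1b
  have hkS : ∀ a b : (geo9Y (f j)).Site, 2 * ((A₀ + (1 + CLip d ℓ) * AW') * tS * rowConst261 (@geo9Y d ℓ hd hL b₀ b₁ Mstar) σ) * ((geo9Y (f j)).M * α₀) * (geo9Y (f j)).L * Real.exp (-((ρ - τ) * (geo9Y (f j)).dist a b)) ≤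
      2 * ((A₀ + (1 + CLip d ℓ) * AW') * tS * rowConst261 (@geo9Y d ℓ hd hL b₀ b₁ Mstar) σ) * (((ℓ + 1 : ℕ) : ℝ)) * ((geo9Y (f j)).M * α₀) * Real.exp (-((ρ - τ) * (geo9Y (f j)).dist a b)) := fun a b => by
    refine mul_le_mul_of_nonneg_right ?_ (Real.exp_nonneg _)
    calc 2 * ((A₀ + (1 + CLip d ℓ) * AW') * tS * rowConst261 (@geo9Y d ℓ hd hL b₀ b₁ Mstar) σ) * ((geo9Y (f j)).M * α₀) * (geo9Y (f j)).L ≤ 2 * ((A₀ + (1 + CLip d ℓ) * AW') * tS * rowConst261 (@geo9Y d ℓ hd hL b₀ b₁ Mstar) σ) * ((geo9Y (f j)).M * α₀) * (((ℓ + 1 : ℕ) : ℝ)) := mul_le_mul_of_nonneg_left hLx hθ20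
      _ = _ := by ring
  have hS1 : StepS (𝔬12 (f j)) (bXH (f j) U) (2 * ((A₀ + (1 + CLip d ℓ) * AW') * tS * rowConst261 (@geo9Y d ℓ hd hL b₀ b₁ Mstar) σ) * (((ℓ + 1 : ℕ) : ℝ)) * ((geo9Y (f j)).M * α₀)) (ρ - τ) U := ⟨hS1a.mono hkS, hS1b.mono hkS⟩
  -- (3) ∇_UG₀T and (4) ∇_{U,ν}G₀T out of 𝔖₂, the latter also out of 𝔖₁
  have hD2 := stepDS_of_lettersS hG hrowx hc0 hB12₀ hB₃ ht hρ hρT hρ0 hρ3 (hθc B12₀ B₃ hB12₀ hB₃) le_rfl (he1 (f j) hM0 α₀ hα ha U hU hU') (hdgDH (f j) hM0 α₀ hα ha U hU hU') hLSx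
  have hθD0 : 0 ≤ 2 * ((B12₀ + (1 + CLip d ℓ) * B₃) * tS * rowConst261 (@geo9Y d ℓ hd hL b₀ b₁ Mstar) σ) * ((geo9Y (f j)).M * α₀) := by positivity
  have hDd2 : ∀ ν : Fin (d + 1), _ := fun ν => stepDdS_of_lettersS hG hrowx hc0 hB12₀ hB₃ ht hρ hρT hρ0 hρ3 (hθc B12₀ B₃ hB12₀ hB₃) le_rfl (he1d (f j) hM0 α₀ hα ha U hU hU') (hdgDHd (f j) hM0 α₀ hα ha U hU hU') hLSx ν
  have hDd1 : ∀ ν : Fin (d + 1),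
      HasMaj (bXH (f j) U) (cNormR 1 (H (f j)) (𝔬12 (f j)).blk hG.lenle 0) (Dd (f j) U ν ∘ₗ (𝔬12 (f j)).G0 U ∘ₗ (𝔬12 (f j)).Tpi U) (fun a b => 2 * ((B12₀ + (1 + CLip d ℓ) * B₃) * tS * rowConst261 (@geo9Y d ℓ hd hL b₀ b₁ Mstar) σ) * ((geo9Y (f j)).M * α₀) * (geo9Y (f j)).L * Real.exp (-((ρ - τ) * (geo9Y (f j)).dist a b))) ∧
      HasMaj (bXH (f j) U) (cNormR 1 (H (f j)) (𝔬12 (f j)).blk hG.lenle 0) (Dd (f j) U ν ∘ₗ (𝔬12 (f j)).G0 U ∘ₗ ((𝔬12 (f j)).Tpi U + (𝔬12 (f j)).T2 U)) (fun a b => 2 * ((B12₀ + (1 + CLip d ℓ) * B₃) * tS * rowConst261 (@geo9Y d ℓ hd hL b₀ b₁ Mstar) σ) * ((geo9Y (f j)).M * α₀) * (geo9Y (f j)).L * Real.exp (-((ρ - τ) * (geo9Y (f j)).dist a b))) := by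
    intro ν
    have hA := fieldS_up hG hFax hθD0 (hasMaj_toR_tgt hG (hDd2 ν).1)
    have hB := fieldS_up hG hFax hθD0 (hasMaj_toR_tgt hG (hDd2 ν).2)
    rw [hτe, Nat.cast_one, show (-1 : ℝ) + 1 = 0 by norm_num] at hA hB
    exact ⟨hA, hB⟩
  -- (5) the Φ^Y probes out of 𝔖₂; (6) the Φ^X probes of the component derivatives out of 𝔖₂ and 𝔖₁
  have hY2 : ∀ β : ℝ, 0 ≤ β → β < 1 → _ := fun β hb0 hb1 =>
    probeYS_of_lettersS hG hrowx hc0 (hBh12 β hb0 hb1) (hBhD β hb0 hb1) ht hρ hρT hρ0 hρ3 (hθc (Bh12 β) (BhD β) (hBh12 β hb0 hb1) (hBhD β hb0 hb1)) le_rfl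
      (h43L (f j) hM0 α₀ hα ha U hU hU' β hb0 hb1) (hYd (f j) hM0 α₀ hα ha U hU hU' β hb0 hb1) hLSx
  have hXd2 : ∀ (ν : Fin (d + 1)) (β : ℝ), 0 ≤ β → β < 1 → _ := fun ν β hb0 hb1 =>
    probeXdS_of_lettersS hG hrowx hc0 (hBh12 β hb0 hb1) (hBdX β hb0 hb1) ht hρ hρT hρ0 hρ3 (hθc (Bh12 β) (BdX β) (hBh12 β hb0 hb1) (hBdX β hb0 hb1)) le_rfl ν
      (h43d (f j) hM0 α₀ hα ha U hU hU' ν β hb0 hb1) (hXd (f j) hM0 α₀ hα ha U hU hU' ν β hb0 hb1) hLSx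
  have hXd1 : ∀ (ν : Fin (d + 1)) (β : ℝ), 0 ≤ β → β < 1 →
      HasMaj (bXH (f j) U) (cNormR 1 (H (f j)) (𝔭A (f j)).blkPX hG.lenle β) (((𝔭A (f j)).ΦX U β ∘ₗ Dd (f j) U ν ∘ₗ (𝔬12 (f j)).G0 U) ∘ₗ (𝔬12 (f j)).Tpi U) (fun a b => 2 * ((Bh12 β + (1 + CLip d ℓ) * BdX β) * tS * rowConst261 (@geo9Y d ℓ hd hL b₀ b₁ Mstar) σ) * ((geo9Y (f j)).M * α₀) * (geo9Y (f j)).L * Real.exp (-((ρ - τ) * (geo9Y (f j)).dist a b))) ∧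
      HasMaj (bXH (f j) U) (cNormR 1 (H (f j)) (𝔭A (f j)).blkPX hG.lenle β) (((𝔭A (f j)).ΦX U β ∘ₗ Dd (f j) U ν ∘ₗ (𝔬12 (f j)).G0 U) ∘ₗ ((𝔬12 (f j)).Tpi U + (𝔬12 (f j)).T2 U)) (fun a b => 2 * ((Bh12 β + (1 + CLip d ℓ) * BdX β) * tS * rowConst261 (@geo9Y d ℓ hd hL b₀ b₁ Mstar) σ) * ((geo9Y (f j)).M * α₀) * (geo9Y (f j)).L * Real.exp (-((ρ - τ) * (geo9Y (f j)).dist a b))) := by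
    intro ν β hb0 hb1
    have h0 : 0 ≤ 2 * ((Bh12 β + (1 + CLip d ℓ) * BdX β) * tS * rowConst261 (@geo9Y d ℓ hd hL b₀ b₁ Mstar) σ) * ((geo9Y (f j)).M * α₀) := by have := hBh12 β hb0 hb1; have := hBdX β hb0 hb1; positivity
    have hA := fieldS_up hG hFax h0 (hXd2 ν β hb0 hb1).1
    have hB := fieldS_up hG hFax h0 (hXd2 ν β hb0 hb1).2
    rw [hτe, show β - 1 + 1 = β by ring] at hA hB
    exact ⟨hA, hB⟩
  -- (7) the Φ^X probes of the step itself: the displayed W-sup probe word moved to `bH13` (one power of `Lʲη`, then the (P2′) sup reading), out of 𝔖₂ and 𝔖₁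
  have hid : HasMaj (bH13 (f j) U) (cNorm 1 (H (f j)) (𝔬12 (f j)).blkW hG.lenle 1) LinearMap.id
      (fun a b => (w13 s44)⁻¹ * (((((ℓ + 1 : ℕ) : ℝ)) * Real.exp ((δ12₃ - τ) * (rNear d ℓ + 1))) * Real.exp (-((δ12₃ - τ) * (geo9Y (f j)).dist a b)))) := by
    rw [hbH13 (f j) U, hblkW12 (f j)]
    exact hasMaj_id_bHZPG_cNorm (f j).toKIdx (trBasis N) (taxiS (f j).toKIdx (bg9YR (Matrix (Fin N) (Fin N) ℂ) (specialUnitaryUnits (Fin N)) R₁ R₂ (f j)) (fun U => U) U) w13 hw13₀ hw13₁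
      hs440 hs441 hw1344 hG.lenle (hlev (f j)) (by linarith) hNr hcf
  have hid' : HasMaj (bH13 (f j) U) (cNormR 1 (H (f j)) (𝔬12 (f j)).blkW hG.lenle (-1)) LinearMap.id
      (fun a b => ((w13 s44)⁻¹ * ((((ℓ + 1 : ℕ) : ℝ)) * Real.exp ((δ12₃ - τ) * (rNear d ℓ + 1)))) * Real.exp (-((δ12₃ - τ) * (geo9Y (f j)).dist a b))) := by
    have h := hasMaj_toR_tgt hG hid
    rw [Nat.cast_one] at h
    exact h.mono fun a b => le_of_eq (by ring)
  have hX2 : ∀ β : ℝ, 0 ≤ β → β < 1 → _ := fun β hb0 hb1 => by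
    have hDv := hasMaj_shift hG hFax (-1 : ℝ) (by norm_num) (hBx13 β hb0 hb1) (hpXDv (f j) hM0 α₀ hα ha U hU hU' β hb0 hb1)
    rw [rpow_abs_eq_pow (geo9Y (f j)).L (-1) 1 (by norm_num), pow_one, hτe, show (0 : ℝ) + -1 = -1 by norm_num, show β - 1 + -1 = β - 2 by ring] at hDv
    have hDv' : HasMaj (cNormR 1 (H (f j)) (𝔬12 (f j)).blkW hG.lenle (-1)) (cNormR 1 (H (f j)) (𝔭A (f j)).blkPX hG.lenle (β - 2)) (((𝔭A (f j)).ΦX U β ∘ₗ (𝔬12 (f j)).G0 U) ∘ₗ (𝔬12 (f j)).Dv U)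
        (fun a b => Bx13 β * (((ℓ + 1 : ℕ) : ℝ)) * Real.exp (-((δ12₃ - τ) * (geo9Y (f j)).dist a b))) :=
      hasMaj_weaken hG (by have := hBx13 β hb0 hb1; positivity) (mul_le_mul_of_nonneg_left hLx (hBx13 β hb0 hb1)) le_rfl hDv
    have hcomp := hasMaj_comp_exp htri hG.dnn hrowx (by have := hBx13 β hb0 hb1; positivity) (by have := hw13₀ s44; positivity) (show 0 ≤ δ12₃ - τ - σ by linarith)
      (by linarith) (by linarith) hDv' hid'
    rw [LinearMap.comp_id, cNormR_κ] at hcomp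
    exact probeXS_of_lettersS hG hrowx hc0 hcX0 (by have := hBx13 β hb0 hb1; positivity) ht hρ hρT hρ0 (by linarith) (hθc cX0 _ hcX0 (by have := hBx13 β hb0 hb1; positivity)) le_rfl
      (hpX0 (f j) hM0 α₀ hα ha U hU hU' β hb0 hb1) hcomp hLSx
  have hX1 : ∀ β : ℝ, 0 ≤ β → β < 1 →
      HasMaj (bXH (f j) U) (cNormR 1 (H (f j)) (𝔭A (f j)).blkPX hG.lenle (β - 1)) (((𝔭A (f j)).ΦX U β ∘ₗ (𝔬12 (f j)).G0 U) ∘ₗ (𝔬12 (f j)).Tpi U) (fun a b => 2 * ((cX0 + (1 + CLip d ℓ) * (1 * (Bx13 β * (((ℓ + 1 : ℕ) : ℝ))) * ((w13 s44)⁻¹ * ((((ℓ + 1 : ℕ) : ℝ)) * Real.exp ((δ12₃ - τ) * (rNear d ℓ + 1)))) * rowConst261 (@geo9Y d ℓ hd hL b₀ b₁ Mstar) σ)) * tS * rowConst261 (@geo9Y d ℓ hd hL b₀ b₁ Mstar) σ) * ((geo9Y (f j)).M * α₀) * (geo9Y (f j)).L * Real.exp (-((ρ - τ) * (geo9Y (f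 j)).dist a b))) ∧
      HasMaj (bXH (f j) U) (cNormR 1 (H (f j)) (𝔭A (f j)).blkPX hG.lenle (β - 1)) (((𝔭A (f j)).ΦX U β ∘ₗ (𝔬12 (f j)).G0 U) ∘ₗ ((𝔬12 (f j)).Tpi U + (𝔬12 (f j)).T2 U)) (fun a b => 2 * ((cX0 + (1 + CLip d ℓ) * (1 * (Bx13 β * (((ℓ + 1 : ℕ) : ℝ))) * ((w13 s44)⁻¹ * ((((ℓ + 1 : ℕ) : ℝ)) * Real.exp ((δ12₃ - τ) * (rNear d ℓ + 1)))) * rowConst261 (@geo9Y d ℓ hd hL b₀ b₁ Mstar) σ)) * tS * rowConst261 (@geo9Y d ℓ hd hL b₀ b₁ Mstar) σ) * ((geo9Y (f j)).M * α₀) * (geo9Y (f j)).L * Real.exp (-((ρ - τ) * (geo9Y (f j)).dist a b))) := by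
    intro β hb0 hb1
    have h0 : 0 ≤ 2 * ((cX0 + (1 + CLip d ℓ) * (1 * (Bx13 β * (((ℓ + 1 : ℕ) : ℝ))) * ((w13 s44)⁻¹ * ((((ℓ + 1 : ℕ) : ℝ)) * Real.exp ((δ12₃ - τ) * (rNear d ℓ + 1)))) * rowConst261 (@geo9Y d ℓ hd hL b₀ b₁ Mstar) σ)) * tS * rowConst261 (@geo9Y d ℓ hd hL b₀ b₁ Mstar) σ) * ((geo9Y (f j)).M * α₀) := by
      have := hBx13 β hb0 hb1; have := hw13₀ s44; positivity
    have hA := fieldS_up hG hFax h0 (hX2 β hb0 hb1).1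
    have hB := fieldS_up hG hFax h0 (hX2 β hb0 hb1).2
    rw [hτe, show β - 2 + 1 = β - 1 by ring] at hA hB
    exact ⟨hA, hB⟩
  exact ⟨hS2, hS1, hD2, fun ν => ⟨hDd2 ν, hDd1 ν⟩, hY2, fun ν β hb0 hb1 => ⟨hXd2 ν β hb0 hb1, hXd1 ν β hb0 hb1⟩, fun β hb0 hb1 => ⟨hX2 β hb0 hb1, hX1 β hb0 hb1⟩⟩

end Summit.QuantumFields.YangMills.BalabanUVNodes.N06StatePairsAtPinsPUJ

end
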